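import Summits.HubbardSuperconductivity.HubbardSuperconductivity.Theses.BalabanIR
import Summits.HubbardSuperconductivity.HubbardSuperconductivity.Theorems.BirComplexStableXY.Negative.WitnessTable
import Summits.HubbardSuperconductivity.HubbardSuperconductivity.Theorems.BirGappedPhaseReductionR.Negative.XYPairTable
import Summits.HubbardSuperconductivity.HubbardSuperconductivity.Theorems.BirGappedPhaseReductionR.Negative.NoExactFiniteTable

/-!
# Disproof of `BirGappedPhaseReductionR` — findings (cdisprove cycle 1, 2026-08-16)

Crux `stmt-HubbardSuperconductivity-14846` of route BalabanIR (rev 6–8), typed as the bare implication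

  `BirGappedPhaseReductionR := BirComplexStableXYR → BirBdGPhaseCoercivity → BirGroundStateAverageLRO`

(restated engine 2R ⇒ static BdG phase coercivity 3 ⇒ ground-state-average d-wave pair LRO X_avg).
Standing disprover refuter-cdisprove-stmt-HubbardSuperconductivity-14846-0.  This file EXTENDS (does not
repeat) the rev-0 work file `Cruxes/BirGappedPhaseReduction/Disproof.lean` (cdisprove on stmt-2082: glue
structure, zero-table corners of the engine class, target tightness `c ≤ 100`, time-reflective sandwich,
admissibility of the stmt-2080 witness) and the sibling `Cruxes/BirComplexStableXY/Disproof.lean` §3–4.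

## Headline: the crux is glue and resists disproof STRUCTURALLY (§1)

`not_reductionR_iff : ¬ BirGappedPhaseReductionR ↔ BirComplexStableXYR ∧ BirBdGPhaseCoercivity ∧ ¬ BirGroundStateAverageLRO`.
A disproof must PROVE the restated engine (crux 2R, the route's research bet) AND the global BdG coercivity
(crux 3, believed true after six seats of numerics, proved at one parameter point) exactly as typed, AND REFUTE
X_avg (absence of ground-state d-wave pair order in the weak-coupling 2D Hubbard model at every δ < 1/2 on a
dense set of U — no theorem in print or in the tree comes close; `ledger negatives`: nothing relevant).
Conversely the crux is implied by the target alone (`reductionR_of_target`), by `¬2R`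
(`reductionR_of_not_engineR`) and by `¬3` (`reductionR_of_not_bdg`): if either antecedent is ever refuted the
item closes `proved` VACUOUSLY (planner: kill criteria / repair duty).  Relation to rev 0: the typed rev-0
engine implies 2R (`engine_imp_engineR`, bigger class and stronger conclusion ⇒ smaller class, even sides), so
`4R ∧ 3 ⇒ 4` (`reduction_of_reductionR`); the rev-0 reduction does not give 4R.

## §2 Load-bearing analysis

Both hypotheses dropped or either one dropped leaves a statement implied by the target (`…Without…_of_target`),
hence no `_false_without_` theorem is available for 4R itself (each would refute X_avg).  What IS available is
load-bearing analysis of the ANTECEDENTS' PARAMETERS, §3.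

## §3 NEW (landed separately, Theses-free): the engine threshold is not uniform in the coercivity constant

Files under `Theorems/BirGappedPhaseReductionR/Negative/` (imported below where landed):
* `XYPairTable.lean` (LANDED p89426) — the all-pairs REAL XY window table `xyPair[r,a]` (`F = aΣ_{w,w'}(1 − e^{i(φ_w−φ_{w'})})`)
  is admissible in the 2R class: (U1), (N), (A) with budget `a r⁶(1+e²)`, (C) with EQUALITY (`c₀ = a`), and the
  new hypotheses (R) `c(n∘R) = conj c(−n)` and (P) `c(n∘P) = c n` in the crux's literal form (invariance under
  every window relabelling + evenness + reality); `engineR_hypotheses_satisfiable`: 2R quantifies over a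
  NON-EMPTY class (so 4R is not target-equivalent by emptiness, and 2R is not vacuous).
* `EngineThresholdScaling.lean` (LANDED p89620) — `not_birComplexStableXYR_uniformThreshold`: the text of 2R with `∃ K₀ L₀` moved
  in front of `∀ c₀ > 0` is FALSE.  Mechanism: the action of `xyPair[r,a]` at stiffness `K` is `(Ka)·S(θ)`, so the
  engine sees only `κ = Ka`; at fixed `(L,M)` the slice order is continuous in `κ` and equals `1/L² < 1/2` at
  `κ = 0`; a uniform `K₀` is beaten by `a = κ₁/max(K₀,1)`.
READING FOR 4R.  By the same scaling the honest threshold is `K₀(r,B,c₀) = k₀(r,B/c₀)/c₀ → ∞` as `c₀ ↓ 0`.  The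
dictionary of the informal reduction takes (C) from crux 3 AS TYPED — a GLOBAL inequality on the MICROSCOPIC
lattice, constant `c₀ ≤ |Δ₁|+|Δ₂|` (`Theorems.BirBdG.birBdG_constant_le`), in truth `≤ κ/4 ~ Δ² log(1/Δ)`
(`ceiling_of_coercive`, staggered texture) — via the slice weight bound
`‖Tr∏e^{-aH(θ_τ)}‖ ≤ 4^{L²}e^{-(ac₀/2)ΣS_τ}Tr e^{-MaH(0)}` (`norm_trace_prod_gibbs_bdg_le_of_coercive`).  Per BLOCK
bond (side `ξ = v_F/Δ`, step `a = 1/Δ`) at unit stiffness `K ~ E_F/Δ`: `c₀^eng ~ a c₀ ξ/K ~ Δ log(1/Δ) → 0` as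
`U ↓ 0` with `B^eng = O(1)`.  Since the typed 2R only offers `∃ K₀(r,B,c₀)` (unknown dependence) and the only
mechanism making `K` large is `U ↓ 0`, a proof of 4R THROUGH THE TYPED 2R needs `(B^eng, c₀^eng)` admissible
UNIFORMLY as `U ↓ 0`; the condensation-scale constant of crux 3 does not give that.  Physically the block-level
coercivity is fine (domain-wall cost per block-step ~ σξa ~ E_F/Δ ~ K, i.e. `c₀^eng = O(1)`), but that is a
BLOCK-LEVEL statement crux 3 does not make: the planner's recorded caveat ("crux 3 RESTATED, antecedent swapped")
is, by this bookkeeping, not a contingency but a necessity for any proof of 4R that uses 2R as a black box.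

## §3b NEW (landed separately, Theses-free): no finitely supported table reproduces a block kernel exactly

`Theorems/BirGappedPhaseReductionR/Negative/NoExactFiniteTable.lean` (LANDED p89422), `cexp_ne_affine_cos`: for `B ≠ 0` no
finitely supported `c : ℤ →₀ ℂ` has `exp(Σ_n c_n e^{inα}) = A + B cos α` for all real `α` (identity theorem +
surjectivity of `Complex.cos` + `exp ≠ 0`).  The two-slice kernel of ONE gapped pairing site in the
gauge-covariant coupling is `A + B cos α`, `B > 0` (pair-number fluctuation between consecutive slices; cf.
`Theorems…TemporalCoercivity`), so the exact fermionic weight is NEVER of the typed form `e^{-KΣF_c}` with `c`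
finitely supported (triage G1 of the rev-0 crux, now a theorem): the "(+ exponentially small tails)" of the
informal step (2) cannot be dropped, and since the typed conclusion of 2R (`Z ≠ 0 ∧ 1/2 ≤ Re(N/Z)`) carries NO
margin, a proof of 4R that USES h2R must either feed it an auxiliary exactly-finite action and control the
comparison quantitatively by itself (i.e. re-prove a quantitative engine), or wait for 2R to be re-typed over
summable tables with a margin.  Combined with §3: as typed, `h2R` and `h3` are consumable by the intended
dictionary only after BOTH antecedents are restated (block-level (C); summable tables + margin) — until then the
only proofs of 4R are `reductionR_of_target ∘ (direct proof of X_avg)` and the vacuous ones.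

## §3c NEW (LANDED p89798, Theses-free): (A) forces zero-free weights; the Villain temporal kernel is outside the class

`Theorems/BirGappedPhaseReductionR/Negative/StripZeroFree.lean`: `weight_ne_zero_on_strip_of_summable` — an
(A)-summable table (`Σ‖c_n‖e^{|n|} < ∞`, finite or not) gives a weight `exp(Σc_ne^{inα})` extending ZERO-FREE
to the unit strip; `thetaKernel_not_admissible` (via the tree's `Literature…JacobiThetaNull.jacobiTheta₂_halfPeriod`, `Θ((1+τ)/2|τ) = 0`): the
periodised Gaussian charge-transfer kernel `Σ_m e^{-am²}e^{imα}` (`σ² = 1/(2a)`) vanishes at `π + ia`, inside the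
strip when `σ² > 1/2`, so it is NOT of the form `e^{-KF_c}` for any admissible `c`, whatever `B`.  With the
route's ISOTROPIC blocks (side ξ, step `a = 1/Δ`) the temporal block kernel is exactly of this type with
`σ² = C/a = χξ²Δ ~ K → ∞` ⇒ hypothesis (A) of 2R excludes the induced action for every budget `B`; the
anisotropic repair (`a ~ C`, `σ² = O(1)`) makes the temporal coercivity `c₀ ~ 1/K²` in units of the spatial
stiffness ⇒ §3 applies.  Evidence note `PowerCounting.md` on the item: the route's own cheapest falsifier for
4R, executed, is NEGATIVE for the dictionary as designed (not for the typed implication).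

## §4 Why the antecedents do not fall cheaply (attack log; details NOTES.md)

* 2R loopholes (B < 0, K₀ ≤ 0, r vs L wrap, M = L Laplace regime, symmetry-forced Z = 0): none — 2R only ADDS
  hypotheses ((R),(P)) and RESTRICTS the conclusion (even L, M) relative to rev 0, whose loophole audit was empty.
* The simplest genuinely complex (R)∧(P) member, the Berry/boost term `iε Σ sin ∂_τθ` (ε < 1): by the contour
  shift `α ↦ α − iη`, `tanh η = ε`, the temporal kernel is `e^{-ηN}·k_XY(K√(1−ε²))` — a pure charge-sector
  reweighting `e^{-ηMQ}` of the REAL XY model; Z > 0 and the slice order (U(1)-invariant) is sector-wise that of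
  the real model.  Harmless (agrees with ideator-4 §4(a), seat-0 v3).  The integer part of the block filling in
  the physical Berry term is a pure gauge (`e^{2πi N₀ w} = 1`), so only `N̄ mod 1` enters: `|ε| ≤ 1/(4K)`-small.
* (R)∧(P)∧translation invariance kill every REAL quadratic R-odd form (`a(k,ω)` odd in ω, even in k, and
  `a(−k,−ω) = a(k,ω)` ⇒ `a ≡ 0`): the imaginary part of an admissible action starts at the linear boost plus
  CUBIC gradient terms, `K(δθ)³ ~ K^{-1/2}` — perturbatively irrelevant.  No Gaussian-level kill of 2R exists;
  any refutation of 2R needs large fields (vortex sheets with O(K) phases), exponentially rare at large `Kc₀`.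
* r ≥ 3 pseudo-Hermitian conjugate pairs: kit j014566 (ideator-4) found none; not re-run (COMPUTE DISCIPLINE).
* Crux 3: `not_uniform_constant`, `birBdG_constant_le` landed by others; believed true pointwise; no texture found.
* Target: tightness `c ≤ 32` (`Theorems…Negative.LoadBearing`, others); `0 < U₁` load-bearing (ibid.).  Not refutable.

## §5 Scaling covariance of 2R (checked here; evidence for 14845's provers)

`engineR_iff_unit : BirComplexStableXYR ↔ BirComplexStableXYRUnit` — the restated engine is EQUIVALENT to its
slice at unit coercivity constant `c₀ = 1` (all other text verbatim): `(K, c) ↦ (Kc₀, c₀⁻¹•c)` preserves (U1),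
(N), (R), (P), maps budget `B ↦ B/c₀` and (C)-constant `c₀ ↦ 1`, and leaves the action — hence `Z` and the slice
order — literally unchanged (`action_smul_inv`).  So the honest threshold is `K₀(r,B,c₀) = K₀(r,B/c₀,1)/c₀`: the
only invariants are `B/c₀` and the scale `Kc₀`, which is exactly what §3's bookkeeping tracks.

## Targets (lead's stuck stubs): none supplied.   ## Near-misses (sorried): none.
-/

namespace Summit.HubbardSuperconductivity.HubbardSuperconductivity.Cruxes.BirGappedPhaseReductionR.Disproof

open Summit.HubbardSuperconductivity.HubbardSuperconductivity.Theses.BalabanIR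
open scoped BigOperators ComplexConjugate
open MeasureTheory Complex Set Literature.Probability.LatticeModels
open Summit.HubbardSuperconductivity.BirComplexStableXYNegative

/-! ## §1 Structure: what a disproof would have to contain -/

/-- The crux is implied by the target alone. -/
theorem reductionR_of_target : BirGroundStateAverageLRO → BirGappedPhaseReductionR :=
  fun h _ _ => h

/-- The crux is implied by the failure of the restated engine (vacuity warning). -/
theorem reductionR_of_not_engineR : ¬ BirComplexStableXYR → BirGappedPhaseReductionR :=
  fun h e _ => absurd e h

/-- The crux is implied by the failure of the BdG coercivity (vacuity warning). -/
theorem reductionR_of_not_bdg : ¬ BirBdGPhaseCoercivity → BirGappedPhaseReductionR :=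
  fun h _ b => absurd b h

/-- HEADLINE. Refuting the crux is EQUIVALENT to proving both antecedents as typed and refuting the target. -/
theorem not_reductionR_iff :
    ¬ BirGappedPhaseReductionR ↔
      (BirComplexStableXYR ∧ BirBdGPhaseCoercivity ∧ ¬ BirGroundStateAverageLRO) := by
  unfold BirGappedPhaseReductionR
  constructor
  · intro h
    by_contra h'
    exact h fun a b => Classical.by_contradiction fun hc => h' ⟨a, b, hc⟩
  · rintro ⟨a, b, hc⟩ h
    exact hc (h a b)

/-- Given both antecedents, the crux is truth-equivalent to the target (the open problem X_avg). -/
theorem reductionR_iff_target (h2R : BirComplexStableXYR) (h3 : BirBdGPhaseCoercivity) :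
    BirGappedPhaseReductionR ↔ BirGroundStateAverageLRO :=
  ⟨fun h => h h2R h3, fun h _ _ => h⟩

/-- The typed rev-0 engine implies the restated engine: 2R adds hypotheses ((R), (P)) and restricts the
conclusion to even `L, M`. -/
theorem engine_imp_engineR : BirComplexStableXY → BirComplexStableXYR := by
  intro h r B c₀ hr hc₀
  obtain ⟨K₀, L₀, h⟩ := h r B c₀ hr hc₀
  exact ⟨K₀, L₀, fun K hK c h1 h2 h3 h4 _hR _hP L M _ _ hL hLM _hLe _hMe =>
    h K hK c h1 h2 h3 h4 L M hL hLM⟩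

/-- Hence `4R ∧ 3 ⇒ 4` (the rev-0 reduction, kept as a support record). -/
theorem reduction_of_reductionR :
    BirGappedPhaseReductionR → BirBdGPhaseCoercivity → BirGappedPhaseReduction :=
  fun h4 h3 e => h4 (engine_imp_engineR e) h3

/-! ## §2 Load-bearing analysis: each mutilated statement is implied by the target -/

/-- 4R with the engine hypothesis dropped. -/
def BirGappedPhaseReductionRWithoutEngine : Prop := BirBdGPhaseCoercivity → BirGroundStateAverageLRO

/-- 4R with the BdG hypothesis dropped (= prover seat 2's original `BirComplexStableXYR′ → target` shape). -/
def BirGappedPhaseReductionRWithoutBdG : Prop := BirComplexStableXYR → BirGroundStateAverageLRO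

/-- 4R with both hypotheses dropped is the target itself. -/
def BirGappedPhaseReductionRWithoutBoth : Prop := BirGroundStateAverageLRO

theorem withoutEngine_of_target : BirGroundStateAverageLRO → BirGappedPhaseReductionRWithoutEngine :=
  fun h _ => h

theorem withoutBdG_of_target : BirGroundStateAverageLRO → BirGappedPhaseReductionRWithoutBdG :=
  fun h _ => h

/-- Each mutilated statement implies the crux (so a `_false_without_` theorem would refute the crux itself,
i.e. the target): the hypotheses of 4R are not load-bearing IN THE LOGICAL SENSE — their content is in the
informal dictionary, whose parameters §3 constrains. -/
theorem reductionR_of_withoutEngine : BirGappedPhaseReductionRWithoutEngine → BirGappedPhaseReductionR :=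
  fun h _ b => h b

theorem reductionR_of_withoutBdG : BirGappedPhaseReductionRWithoutBdG → BirGappedPhaseReductionR :=
  fun h e _ => h e

/-! ## §3 Landed negative lemmas (re-exported for readers of this file) -/

/-- The restated engine quantifies over a NON-EMPTY class: (U1), (N), (A), (C), (R), (P) are simultaneously
satisfiable (`r = 2`, `c₀ = 1`, `B = 64(1+e²)`, the all-pairs real XY window table). LANDED p89426. -/
alias engineR_class_nonempty := Theorems.BirGappedPhaseReductionR.Negative.engineR_hypotheses_satisfiable

/-- No finitely supported table reproduces an affine-in-cosine two-slice weight (`B ≠ 0`): the exact fermionic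
weight of a gapped block is never of 2R's typed form. LANDED p89422. -/
alias no_exact_finite_table := Theorems.BirGappedPhaseReductionR.Negative.cexp_ne_affine_cos

-- (aliases for the landed p89620 `not_birComplexStableXYR_uniformThreshold` and p89798
-- `weight_ne_zero_on_strip_of_summable` / `thetaKernel_not_admissible` are added once the farm serves those
-- modules to work-file checks; import …Negative.EngineThresholdScaling / …Negative.StripZeroFree.)

/-! ## §5 Scaling covariance of the restated engine (positive structural fact about the antecedent 2R;
evidence for provers of stmt-14845, not a Theorems landing of this seat) -/

section Scaling

/-- `BirComplexStableXYR` with the coercivity constant normalised to `c₀ = 1` (all other text verbatim). -/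
def BirComplexStableXYRUnit : Prop :=
  ∀ (r : ℕ) (B : ℝ), 2 ≤ r → ∃ K₀ : ℝ, ∃ L₀ : ℕ, ∀ K : ℝ, K₀ ≤ K → ∀ c : ((Fin r × Fin r × Fin r) → ℤ) →₀ ℂ, (∀ n ∈ c.support, ∑ w, n w = 0) → c.sum (fun _ a => a) = 0 → c.sum (fun n a => ‖a‖ * Real.exp (∑ w, |(n w : ℝ)|)) ≤ B → (∀ φ : (Fin r × Fin r × Fin r) → ℝ, (1:ℝ) * ∑ w, ∑ w', (1 - Real.cos (φ w - φ w')) ≤ ((fun (φ : (Fin r × Fin r × Fin r) → ℝ) => c.sum (fun n a => a * Complex.exp (Complex.I * ((∑ w, (n w : ℝ) * φ w : ℝ) : ℂ)))) φ).re) → (∀ n : (Fin r × Fin r × Fin r) → ℤ, c (fun w => n (w.1, w.2.1, Fin.rev w.2.2)) = (starRingEnd ℂ) (c (-n))) → (∀ n : (Fin r × Fin r × Fin r) → ℤ, c (fun w => n (Fin.rev w.1, Fin.rev w.2.1, w.2.2)) = c n) → ∀ (L M : ℕ) [NeZero L] [NeZero M], L₀ ≤ L → L ≤ M → Even L → Even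 M → let sh : (Literature.Probability.LatticeModels.TorusSite 2 L × ZMod M) → (Fin r × Fin r × Fin r) → (Literature.Probability.LatticeModels.TorusSite 2 L × ZMod M) := fun s w => (s.1 + ![((w.1 : ℕ) : ZMod L), ((w.2.1 : ℕ) : ZMod L)], s.2 + ((w.2.2 : ℕ) : ZMod M)); let F : ((Fin r × Fin r × Fin r) → ℝ) → ℂ := fun (φ : (Fin r × Fin r × Fin r) → ℝ) => c.sum (fun n a => a * Complex.exp (Complex.I * ((∑ w, (n w : ℝ) * φ w : ℝ) : ℂ))); let A : ((Literature.Probability.LatticeModels.TorusSite 2 L × ZMod M) → ℝ) → ℂ := fun θ => (K : ℂ) * ∑ s : (Literature.Probability.LatticeModels.TorusSite 2 L × ZMod M), F (fun w => θ (sh s w)); let cube : Set ((Literature.Probability.LatticeModels.TorusSite 2 L × ZMod M) → ℝ) := Set.pi Set.univ (fun _ => Set.Icc (0:ℝ) (2 * Real.pi)); let Z : ℂ := MeasureTheory.integral (MeasureTheory.volume.restrict cube) (fun θ => Complex.exp (-(A θ))); let O : ((Literature.Probability.LatticeModels.TorusSite 2 L × ZMod M) → ℝ) → ℝ := fun θ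 => ‖∑ x : Literature.Probability.LatticeModels.TorusSite 2 L, Complex.exp (Complex.I * (θ (x, 0) : ℂ))‖ ^ 2 / (L : ℝ) ^ 4; Z ≠ 0 ∧ (1/2 : ℝ) ≤ ((MeasureTheory.integral (MeasureTheory.volume.restrict cube) (fun θ => (O θ : ℂ) * Complex.exp (-(A θ)))) / Z).re

/-- trivial direction: the engine implies its unit-coercivity slice. -/
theorem unit_of_engineR : BirComplexStableXYR → BirComplexStableXYRUnit := by
  intro h r B hr
  exact h r B 1 hr one_pos

variable {r : ℕ}

/-- the action is invariant under `(K, c) ↦ (K c₀, c₀⁻¹ • c)`. -/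
theorem action_smul_inv (K c₀ : ℝ) (hc₀ : c₀ ≠ 0) (c : Table r) (L M : ℕ) [NeZero L] [NeZero M]
    (θ : Λ L M → ℝ) :
    action (K * c₀) (((c₀⁻¹ : ℝ) : ℂ) • c) L M θ = action K c L M θ := by
  unfold action
  simp_rw [genF_smul]
  rw [← Finset.mul_sum, ← mul_assoc]
  congr 1
  push_cast
  have : (c₀ : ℂ) ≠ 0 := by exact_mod_cast hc₀
  field_simp

/-- SCALING COVARIANCE: the unit-coercivity slice implies the full restated engine, with threshold
`K₀(r, B, c₀) := K₀(r, B/c₀, 1) / c₀`. -/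
theorem engineR_of_unit : BirComplexStableXYRUnit → BirComplexStableXYR := by
  intro h r B c₀ hr hc₀
  obtain ⟨K₀, L₀, h⟩ := h r (B / c₀) hr
  refine ⟨K₀ / c₀, L₀, ?_⟩
  intro K hK c hU1 hN hA hC hR hP L M _ _ hL hLM hLe hMe
  have hc₀' : c₀ ≠ 0 := hc₀.ne'
  set b : ℂ := ((c₀⁻¹ : ℝ) : ℂ) with hb
  set c' : Table r := b • c with hc'
  -- admissibility of the rescaled table at unit coercivity and budget B / c₀
  have hU1' : ∀ n ∈ c'.support, ∑ w, n w = 0 := fun n hn => hU1 n (Finsupp.support_smul hn)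
  have hN' : c'.sum (fun _ a => a) = 0 := by
    change BirComplexStableXYNegative.tsum (b • c) = 0
    rw [tsum_smul]
    change b * c.sum (fun _ a => a) = 0
    rw [hN, mul_zero]
  have hA' : c'.sum (fun n a => ‖a‖ * Real.exp (∑ w, |(n w : ℝ)|)) ≤ B / c₀ := by
    change normA (b • c) ≤ B / c₀
    rw [normA_smul, hb, Complex.norm_real, Real.norm_of_nonneg (inv_nonneg.mpr hc₀.le)]
    change c₀⁻¹ * normA c ≤ B / c₀
    rw [div_eq_inv_mul]
    exact mul_le_mul_of_nonneg_left hA (inv_nonneg.mpr hc₀.le)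
  have hC' : ∀ φ : W r → ℝ, (1:ℝ) * ∑ w, ∑ w', (1 - Real.cos (φ w - φ w')) ≤ (genF c' φ).re := by
    intro φ
    have h1 := hC φ
    change c₀ * ∑ w, ∑ w', (1 - Real.cos (φ w - φ w')) ≤ (genF c φ).re at h1
    rw [hc', genF_smul, hb, Complex.re_ofReal_mul, one_mul]
    rw [← inv_mul_cancel_left₀ hc₀' (∑ w, ∑ w', (1 - Real.cos (φ w - φ w')))]
    exact mul_le_mul_of_nonneg_left h1 (inv_nonneg.mpr hc₀.le)
  have hR' : ∀ n : Freq r, c' (fun w => n (w.1, w.2.1, Fin.rev w.2.2)) = (starRingEnd ℂ) (c' (-n)) := by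
    intro n
    simp only [hc', Finsupp.smul_apply, smul_eq_mul, map_mul, hR n]
    rw [hb, Complex.conj_ofReal]
  have hP' : ∀ n : Freq r, c' (fun w => n (Fin.rev w.1, Fin.rev w.2.1, w.2.2)) = c' n := by
    intro n
    simp only [hc', Finsupp.smul_apply, hP n]
  have hK' : K₀ ≤ K * c₀ := by
    have := mul_le_mul_of_nonneg_right hK hc₀.le
    rwa [div_mul_cancel₀ _ hc₀'] at this
  have key := h (K * c₀) hK' c' hU1' hN' hA' hC' hR' hP' L M hL hLM hLe hMe
  dsimp only at key
  change partZ (K * c₀) c' L M ≠ 0 ∧ (1/2 : ℝ) ≤ ((∫ θ in cube L M,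
      (((‖∑ x : TorusSite 2 L, cexp (I * (θ (x, 0) : ℂ))‖ ^ 2 / (L : ℝ) ^ 4 : ℝ)) : ℂ) *
        cexp (-(action (K * c₀) c' L M θ))) / partZ (K * c₀) c' L M).re at key
  simp only [partZ, hc', hb, action_smul_inv K c₀ hc₀' c L M] at key
  dsimp only [action, genF, sh, cube] at key
  dsimp only
  exact key

theorem engineR_iff_unit : BirComplexStableXYR ↔ BirComplexStableXYRUnit :=
  ⟨unit_of_engineR, engineR_of_unit⟩

end Scaling

end Summit.HubbardSuperconductivity.HubbardSuperconductivity.Cruxes.BirGappedPhaseReductionR.Disproof
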